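import Summits.QuantumFields.BalabanUV.T4Continuum.Support.NE3QuadRemainderGaugeStep
import Summits.QuantumFields.BalabanUV.T4Continuum.Support.NE3CovariantWeitzenbock
import Summits.QuantumFields.BalabanUV.T4Continuum.Support.NE7CornerGaugeRegauge
import Summits.QuantumFields.BalabanUV.T4Continuum.Support.MinimalActionWitness
import HarnessLib

/-!
# NE7PinningDivergence — THE PINNING STEP IN THE DIVERGENCE CURRENCY: re-gauging the links `e^{A}` by a unitary `w⁻¹` with first differences `ℓ` and second
# differences `σ₂` moves the flat covariant divergence of the logarithm by `2dℓs + (4∕3)d(σ₂ + ℓ²) + 16384·d·sℓ` only — a (−2)-size amount when `ℓ = O(ω∕Λ)`,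
# `σ₂ = O(ω∕Λ²)`, `s = O(δ∕Λ)` (`NE7PinningDivergence`)

Cell `pub-balaban`, lineage `t4-ne7-p1` (CRUX PROVER NE7 #1 = OWNER of row NE7), gen 73; brick (P′) of ROAD v3 (`t4/b2b-balaban-t4-ne7-p1-g73/REP-FLAT-ROAD-v3.md` §2 (P)):
in Bałaban's induction with per-level corner pinning (p2's (154e) interpolant `w`: `‖∇w‖ ≤ 8ω∕Λ`, `‖∇²w‖ ≤ 165ω∕Λ²`) the exact-gauge representative `Z` is re-gauged to
`log (w(y)⁻¹ e^{Z(y,κ)} w(y+e_κ))`; row NE3's exact step at the next level (`Spine/NE3/FlatLandauRep.exists_flatLandauRep_of_supFacts`, binder `hb₀`) needs the sup of the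
flat covariant divergence `covDiv 1 (log links)` of the INPUT.  THIS FILE: the identity `log(w⁻¹e^{A}w′) = Ad(w⁻¹)A + log(w⁻¹w′) + BCH₂` (row NE3's letter
`NE3QuadRemainderGaugeStep.norm_mlog_exp_mul_exp_sub_le`, `‖BCH₂‖ ≤ 4096‖A‖‖log(w⁻¹w′)‖`), and the three divergence letters: conjugation by a slowly varying unitary
(`2dℓs`), the pure gauge `log(w(y)⁻¹w(y+e_κ))` (its divergence is a SECOND difference of `w`: `(4∕3)d(σ₂ + ℓ²)`), and the BCH junk (`2d·8192·sℓ`).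

CONTENT ([folklore]; 0 def, 0 sorry): §1 `norm_Ad_sub_Ad_le`, `covDiv_flatCfg_add`, `norm_covDiv_flatCfg_le`; §2 `norm_transporter_second_diff_le` (the identity
`w(x)⁻¹w(x+e) − w(x−e)⁻¹w(x) = w(x)⁻¹[second difference] + (w(x)⁻¹ − w(x−e)⁻¹)(w(x) − w(x−e))`); §3 **`pinning_divergence`** (the END: links, logarithm, sup and divergence of
the re-gauged field).

HONEST FRAMING (page 1): bookkeeping on OUR T4 carriers; nothing of Bałaban's asserted; REP♭ NOT proved; (APE) NOT proved; NE7 NOT PRINTED ∕ NOT PROVED (0∕1); spine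
PROVED 0∕9; rung (B)+1 finite T⁴ — NOT infinite volume, NOT mass gap, NOT BetaPertH, NOT Clay.  PLACEMENT: our lemma, under `Summits/QuantumFields/BalabanUV/`.
Continuum YM on T⁴ ⇐ BetaPertH ∧ nine spine estimates (0/9 proved); BetaPertH ⇐ (D1) ∧ (D4) ∧ CAP+tail; G-an2-4 gates asym, D1 and NE2/3/4.
-/

set_option autoImplicit false

open scoped BigOperators Matrix Matrix.Norms.L2Operator
open NormedSpace Finset

namespace Summit.QuantumFields.BalabanUV.T4Continuum.NE7PinningDivergence

open Literature.MathematicalPhysics.QuantumFieldTheory.Balaban1983to89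
open B7Prop1Explicit B7Prop2Explicit MatrixLog
open T4AveragingDeficitWall (Ad IsUnitaryCfg)
open MinimalActionWitness (flatCfg)
open NE3EnergyShapes (IsUnitarySite)
open NE3CovariantWeitzenbock (covDiv covDiv_flatCfg)
open NE3QuadRemainderGaugeStep (norm_mlog_exp_mul_exp_sub_le)
open NE7ExpLogSecondOrder (norm_mlog_sub_mlog_le_four_thirds)
open NE7GeodesicSecondOrder (norm_inv_sub_inv)

noncomputable section

variable {d : ℕ} {n : Type} [Fintype n] [DecidableEq n] [Nonempty n]

/-! ## §1 Small letters on the flat covariant divergence -/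

/-- conjugations by nearby unitaries: `‖Ad_p Y − Ad_q Y‖ ≤ 2‖p − q‖·‖Y‖`. [folklore] -/
theorem norm_Ad_sub_Ad_le {p q : (Matrix n n ℂ)ˣ} (hp : p ∈ unitaryUnits (Matrix n n ℂ)) (hq : q ∈ unitaryUnits (Matrix n n ℂ)) (Y : (Matrix n n ℂ)) :
    ‖Ad p Y - Ad q Y‖ ≤ 2 * ‖(p : (Matrix n n ℂ)) - q‖ * ‖Y‖ := by
  letI : CStarAlgebra (Matrix n n ℂ) := {}
  have hid : Ad p Y - Ad q Y = ((p : (Matrix n n ℂ)) - q) * Y * ((p⁻¹ : (Matrix n n ℂ)ˣ) : (Matrix n n ℂ)) + (q : (Matrix n n ℂ)) * Y * (((p⁻¹ : (Matrix n n ℂ)ˣ) : (Matrix n n ℂ)) - ((q⁻¹ : (Matrix n n ℂ)ˣ) : (Matrix n n ℂ))) := by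
    simp only [Ad]; noncomm_ring
  rw [hid]
  have hpi := (unitaryUnits (Matrix n n ℂ)).inv_mem hp
  have n1 : ‖((p⁻¹ : (Matrix n n ℂ)ˣ) : (Matrix n n ℂ))‖ = 1 := CStarRing.norm_of_mem_unitary (mem_unitaryUnits.mp hpi)
  have n2 : ‖(q : (Matrix n n ℂ))‖ = 1 := CStarRing.norm_of_mem_unitary (mem_unitaryUnits.mp hq)
  calc _ ≤ ‖((p : (Matrix n n ℂ)) - q) * Y * ((p⁻¹ : (Matrix n n ℂ)ˣ) : (Matrix n n ℂ))‖ + ‖(q : (Matrix n n ℂ)) * Y * (((p⁻¹ : (Matrix n n ℂ)ˣ) : (Matrix n n ℂ)) - ((q⁻¹ : (Matrix n n ℂ)ˣ) : (Matrix n n ℂ)))‖ := norm_add_le _ _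
    _ ≤ ‖(p : (Matrix n n ℂ)) - q‖ * ‖Y‖ * 1 + 1 * ‖Y‖ * ‖(p : (Matrix n n ℂ)) - q‖ := by
        refine add_le_add ?_ ?_
        · calc _ ≤ ‖((p : (Matrix n n ℂ)) - q) * Y‖ * ‖((p⁻¹ : (Matrix n n ℂ)ˣ) : (Matrix n n ℂ))‖ := norm_mul_le _ _
            _ ≤ ‖(p : (Matrix n n ℂ)) - q‖ * ‖Y‖ * 1 := by rw [n1]; exact mul_le_mul_of_nonneg_right (norm_mul_le _ _) zero_le_one
        · calc _ ≤ ‖(q : (Matrix n n ℂ)) * Y‖ * ‖((p⁻¹ : (Matrix n n ℂ)ˣ) : (Matrix n n ℂ)) - ((q⁻¹ : (Matrix n n ℂ)ˣ) : (Matrix n n ℂ))‖ := norm_mul_le _ _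
            _ ≤ 1 * ‖Y‖ * ‖(p : (Matrix n n ℂ)) - q‖ := by
                rw [norm_inv_sub_inv hp hq]
                exact mul_le_mul_of_nonneg_right ((norm_mul_le _ _).trans (by rw [n2])) (norm_nonneg _)
    _ = 2 * ‖(p : (Matrix n n ℂ)) - q‖ * ‖Y‖ := by ring

omit [Nonempty n] in
/-- the flat divergence is additive. [folklore] -/
theorem covDiv_flatCfg_add (X Y : Site d → Fin d → (Matrix n n ℂ)) (x : Site d) :
    covDiv (flatCfg (d := d) (n := n)) (fun y μ => X y μ + Y y μ) x = covDiv (flatCfg (d := d) (n := n)) X x + covDiv (flatCfg (d := d) (n := n)) Y x := by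
  rw [covDiv_flatCfg, covDiv_flatCfg, covDiv_flatCfg, ← sum_add_distrib]
  exact sum_congr rfl fun μ _ => by abel

omit [Nonempty n] in
/-- the flat divergence of a field with sup `r` is at most `2d·r`. [folklore] -/
theorem norm_covDiv_flatCfg_le (X : Site d → Fin d → (Matrix n n ℂ)) {r : ℝ} (hX : ∀ (y : Site d) (μ : Fin d), ‖X y μ‖ ≤ r) (x : Site d) :
    ‖covDiv (flatCfg (d := d) (n := n)) X x‖ ≤ 2 * d * r := by
  rw [covDiv_flatCfg]
  calc ‖∑ μ : Fin d, (X x μ - X (x - e μ) μ)‖ ≤ ∑ μ : Fin d, ‖X x μ - X (x - e μ) μ‖ := norm_sum_le _ _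
    _ ≤ ∑ _μ : Fin d, 2 * r := sum_le_sum fun μ _ => (norm_sub_le _ _).trans (by linarith [hX x μ, hX (x - e μ) μ])
    _ = 2 * d * r := by rw [sum_const, card_univ, Fintype.card_fin, nsmul_eq_mul]; ring

/-! ## §2 The pure gauge `w(y)⁻¹w(y+e_κ)`: its divergence is a second difference -/

/-- `‖w(x)⁻¹w(x+e) − w(x−e)⁻¹w(x)‖ ≤ σ₂ + ℓ²` from `‖(w(x+e) − w(x)) − (w(x) − w(x−e))‖ ≤ σ₂` and first differences `≤ ℓ`. [folklore] -/
theorem norm_transporter_second_diff_le {a b c : (Matrix n n ℂ)ˣ} (ha : a ∈ unitaryUnits (Matrix n n ℂ)) (hb : b ∈ unitaryUnits (Matrix n n ℂ)) {ℓ σ₂ : ℝ}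
    (h1 : ‖(c : (Matrix n n ℂ)) - b‖ ≤ ℓ) (h2 : ‖(b : (Matrix n n ℂ)) - a‖ ≤ ℓ) (h3 : ‖((c : (Matrix n n ℂ)) - b) - ((b : (Matrix n n ℂ)) - a)‖ ≤ σ₂) :
    ‖((b⁻¹ * c : (Matrix n n ℂ)ˣ) : (Matrix n n ℂ)) - ((a⁻¹ * b : (Matrix n n ℂ)ˣ) : (Matrix n n ℂ))‖ ≤ σ₂ + ℓ ^ 2 := by
  letI : CStarAlgebra (Matrix n n ℂ) := {}
  have hbi := (unitaryUnits (Matrix n n ℂ)).inv_mem hb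
  have hai := (unitaryUnits (Matrix n n ℂ)).inv_mem ha
  have hid : ((b⁻¹ * c : (Matrix n n ℂ)ˣ) : (Matrix n n ℂ)) - ((a⁻¹ * b : (Matrix n n ℂ)ˣ) : (Matrix n n ℂ))
      = ((b⁻¹ : (Matrix n n ℂ)ˣ) : (Matrix n n ℂ)) * (((c : (Matrix n n ℂ)) - b) - ((b : (Matrix n n ℂ)) - a)) + (((b⁻¹ : (Matrix n n ℂ)ˣ) : (Matrix n n ℂ)) - ((a⁻¹ : (Matrix n n ℂ)ˣ) : (Matrix n n ℂ))) * ((b : (Matrix n n ℂ)) - a) := by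
    have e1 : ((b⁻¹ : (Matrix n n ℂ)ˣ) : (Matrix n n ℂ)) * (b : (Matrix n n ℂ)) = 1 := by rw [← Units.val_mul, inv_mul_cancel, Units.val_one]
    have e2 : ((a⁻¹ : (Matrix n n ℂ)ˣ) : (Matrix n n ℂ)) * (a : (Matrix n n ℂ)) = 1 := by rw [← Units.val_mul, inv_mul_cancel, Units.val_one]
    simp only [Units.val_mul, mul_sub, sub_mul, e1, e2]
    abel
  rw [hid]
  have nb : ‖((b⁻¹ : (Matrix n n ℂ)ˣ) : (Matrix n n ℂ))‖ = 1 := CStarRing.norm_of_mem_unitary (mem_unitaryUnits.mp hbi)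
  have hℓ0 : 0 ≤ ℓ := (norm_nonneg _).trans h1
  calc _ ≤ ‖((b⁻¹ : (Matrix n n ℂ)ˣ) : (Matrix n n ℂ)) * (((c : (Matrix n n ℂ)) - b) - ((b : (Matrix n n ℂ)) - a))‖ + ‖(((b⁻¹ : (Matrix n n ℂ)ˣ) : (Matrix n n ℂ)) - ((a⁻¹ : (Matrix n n ℂ)ˣ) : (Matrix n n ℂ))) * ((b : (Matrix n n ℂ)) - a)‖ := norm_add_le _ _
    _ ≤ 1 * σ₂ + ℓ * ℓ := by
        refine add_le_add ?_ ?_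
        · exact (norm_mul_le _ _).trans (by rw [nb]; exact mul_le_mul_of_nonneg_left h3 zero_le_one)
        · refine (norm_mul_le _ _).trans (mul_le_mul ?_ h2 (norm_nonneg _) hℓ0)
          rw [norm_inv_sub_inv hb ha]; exact h2
    _ = σ₂ + ℓ ^ 2 := by ring

/-! ## §3 THE PINNING STEP IN THE DIVERGENCE CURRENCY -/

/-- **THE END.**  `W` unitary with links `e^{A}`, `‖A‖ ≤ s ≤ 1∕100`; `w` unitary with first differences `≤ ℓ ≤ 1∕200` and second differences `≤ σ₂`.  Then the
links of `W^{w⁻¹}` (`y ↦ w(y)⁻¹·W(y,κ)·w(y+e_κ)`) are `e^{A′}` with `A′ = log(link)`,  `‖W^{w⁻¹} − 1‖ ≤ 2s + ℓ`,  `‖A′‖ ≤ 2(2s + ℓ)`,  and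
**`‖covDiv 1 A′ (x)‖ ≤ ‖covDiv 1 A (x)‖ + 2dℓs + (4∕3)d(σ₂ + ℓ²) + 16384·d·s·ℓ`**. [folklore] -/
theorem pinning_divergence {W : Site d → Fin d → (Matrix n n ℂ)ˣ} (hWu : IsUnitaryCfg W) {A : Site d → Fin d → (Matrix n n ℂ)}
    (hWA : ∀ (y : Site d) (κ : Fin d), ((W y κ : (Matrix n n ℂ)ˣ) : (Matrix n n ℂ)) = exp (A y κ)) {s : ℝ} (hs0 : 0 ≤ s) (hA : ∀ (y : Site d) (κ : Fin d), ‖A y κ‖ ≤ s)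
    (hs : s ≤ 1 / 100)
    {w : Site d → (Matrix n n ℂ)ˣ} (hwU : IsUnitarySite w) {ℓ σ₂ : ℝ} (hℓ0 : 0 ≤ ℓ) (hℓ : ∀ (y : Site d) (μ : Fin d), ‖(w (y + e μ) : (Matrix n n ℂ)) - w y‖ ≤ ℓ)
    (hℓs : ℓ ≤ 1 / 200)
    (hσ₂ : ∀ (y : Site d) (μ : Fin d), ‖((w (y + e μ) : (Matrix n n ℂ)) - w y) - ((w y : (Matrix n n ℂ)) - w (y - e μ))‖ ≤ σ₂) :
    (∀ (y : Site d) (κ : Fin d), ((gaugeAct (fun y => (w y)⁻¹) W y κ : (Matrix n n ℂ)ˣ) : (Matrix n n ℂ))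
        = exp (mlog ((gaugeAct (fun y => (w y)⁻¹) W y κ : (Matrix n n ℂ)ˣ) : (Matrix n n ℂ)))) ∧
    (∀ (y : Site d) (κ : Fin d), ‖((gaugeAct (fun y => (w y)⁻¹) W y κ : (Matrix n n ℂ)ˣ) : (Matrix n n ℂ)) - 1‖ ≤ 2 * s + ℓ) ∧
    (∀ (y : Site d) (κ : Fin d), ‖mlog ((gaugeAct (fun y => (w y)⁻¹) W y κ : (Matrix n n ℂ)ˣ) : (Matrix n n ℂ))‖ ≤ 2 * (2 * s + ℓ)) ∧
    (∀ x : Site d, ‖covDiv (flatCfg (d := d) (n := n)) (fun y κ => mlog ((gaugeAct (fun y => (w y)⁻¹) W y κ : (Matrix n n ℂ)ˣ) : (Matrix n n ℂ))) x‖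
      ≤ ‖covDiv (flatCfg (d := d) (n := n)) A x‖ + 2 * d * ℓ * s + 4 / 3 * d * (σ₂ + ℓ ^ 2) + 16384 * d * s * ℓ) := by
  letI : CStarAlgebra (Matrix n n ℂ) := {}
  letI : NormedAlgebra ℚ (Matrix n n ℂ) := NormedAlgebra.restrictScalars ℚ ℝ (Matrix n n ℂ)
  -- the link, factored: `w(y)⁻¹ e^{A} w(y') = e^{Ad(w(y)⁻¹)A} · (w(y)⁻¹ w(y'))`
  set X : Site d → Fin d → (Matrix n n ℂ) := fun y κ => Ad ((w y)⁻¹) (A y κ) with hXdef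
  set T : Site d → Fin d → (Matrix n n ℂ)ˣ := fun y κ => (w y)⁻¹ * w (y + e κ) with hTdef
  have hTU : ∀ y κ, T y κ ∈ unitaryUnits (Matrix n n ℂ) := fun y κ => (unitaryUnits (Matrix n n ℂ)).mul_mem ((unitaryUnits (Matrix n n ℂ)).inv_mem (hwU _)) (hwU _)
  have hT1 : ∀ y κ, ‖((T y κ : (Matrix n n ℂ)ˣ) : (Matrix n n ℂ)) - 1‖ ≤ ℓ := by
    intro y κ
    have e1 : (((w y)⁻¹ : (Matrix n n ℂ)ˣ) : (Matrix n n ℂ)) * (w y : (Matrix n n ℂ)) = 1 := by rw [← Units.val_mul, inv_mul_cancel, Units.val_one]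
    have h : ((T y κ : (Matrix n n ℂ)ˣ) : (Matrix n n ℂ)) - 1 = (((w y)⁻¹ : (Matrix n n ℂ)ˣ) : (Matrix n n ℂ)) * ((w (y + e κ) : (Matrix n n ℂ)) - w y) := by
      rw [hTdef, Units.val_mul, mul_sub, e1]
    rw [h, CStarRing.norm_mem_unitary_mul _ (mem_unitaryUnits.mp ((unitaryUnits (Matrix n n ℂ)).inv_mem (hwU y)))]
    exact hℓ y κ
  set D : Site d → Fin d → (Matrix n n ℂ) := fun y κ => mlog ((T y κ : (Matrix n n ℂ)ˣ) : (Matrix n n ℂ)) with hDdef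
  have hD : ∀ y κ, ‖D y κ‖ ≤ 2 * ℓ := fun y κ => by
    rw [hDdef]
    exact (norm_mlog_le_two_mul ((hT1 y κ).trans (by linarith))).trans (by linarith [hT1 y κ])
  have hexpD : ∀ y κ, exp (D y κ) = ((T y κ : (Matrix n n ℂ)ˣ) : (Matrix n n ℂ)) := fun y κ => exp_mlog ((hT1 y κ).trans_lt (by linarith))
  have hX : ∀ y κ, ‖X y κ‖ ≤ s := by
    intro y κ
    simp only [hXdef, Ad]
    rw [CStarRing.norm_mul_mem_unitary _ (mem_unitaryUnits.mp ((unitaryUnits (Matrix n n ℂ)).inv_mem ((unitaryUnits (Matrix n n ℂ)).inv_mem (hwU y)))),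
      CStarRing.norm_mem_unitary_mul _ (mem_unitaryUnits.mp ((unitaryUnits (Matrix n n ℂ)).inv_mem (hwU y)))]
    exact hA y κ
  have hexpX : ∀ y κ, exp (X y κ) = (((w y)⁻¹ : (Matrix n n ℂ)ˣ) : (Matrix n n ℂ)) * exp (A y κ) * (w y : (Matrix n n ℂ)) := by
    intro y κ
    simp only [hXdef, Ad, inv_inv]
    exact exp_units_conj' (w y) (A y κ)
  have hlink : ∀ y κ, ((gaugeAct (fun y => (w y)⁻¹) W y κ : (Matrix n n ℂ)ˣ) : (Matrix n n ℂ)) = exp (X y κ) * exp (D y κ) := by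
    intro y κ
    rw [hexpX, hexpD, hTdef]
    simp only [gaugeAct, Units.val_mul, inv_inv, hWA, mul_assoc]
    rw [← mul_assoc (w y : (Matrix n n ℂ)) (((w y)⁻¹ : (Matrix n n ℂ)ˣ) : (Matrix n n ℂ)), ← Units.val_mul, mul_inv_cancel, Units.val_one, one_mul]
  -- the logarithm: `A' = X + D + R`, `‖R‖ ≤ 4096 s · 2ℓ`
  set A' : Site d → Fin d → (Matrix n n ℂ) := fun y κ => mlog ((gaugeAct (fun y => (w y)⁻¹) W y κ : (Matrix n n ℂ)ˣ) : (Matrix n n ℂ)) with hA'def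
  set R : Site d → Fin d → (Matrix n n ℂ) := fun y κ => A' y κ - (X y κ + D y κ) with hRdef
  have hR : ∀ y κ, ‖R y κ‖ ≤ 4096 * s * (2 * ℓ) := by
    intro y κ
    simp only [hRdef, hA'def, hlink]
    have h := norm_mlog_exp_mul_exp_sub_le ((hX y κ).trans hs) ((hD y κ).trans (by linarith))
    refine h.trans ?_
    have h3 : ‖X y κ‖ * ‖D y κ‖ ≤ s * (2 * ℓ) := mul_le_mul (hX y κ) (hD y κ) (norm_nonneg _) hs0
    nlinarith [h3]
  have hA'eq : ∀ y κ, A' y κ = X y κ + D y κ + R y κ := fun y κ => by simp only [hRdef]; abel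
  -- link sizes
  have hlink1 : ∀ y κ, ‖((gaugeAct (fun y => (w y)⁻¹) W y κ : (Matrix n n ℂ)ˣ) : (Matrix n n ℂ)) - 1‖ ≤ 2 * s + ℓ := by
    intro y κ
    rw [hlink, hexpD]
    have hE : ‖exp (X y κ) - 1‖ ≤ 2 * s := by
      have h := B7Transfer.norm_exp_sub_one_le_of_le _ (hX y κ)
      have h2 : Real.exp s - 1 ≤ 2 * s := by
        have := Real.abs_exp_sub_one_sub_id_le (x := s) (by rw [abs_of_nonneg hs0]; linarith)
        have := (abs_le.mp this).2
        nlinarith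
      linarith
    calc ‖exp (X y κ) * ((T y κ : (Matrix n n ℂ)ˣ) : (Matrix n n ℂ)) - 1‖ = ‖(exp (X y κ) - 1) * ((T y κ : (Matrix n n ℂ)ˣ) : (Matrix n n ℂ)) + (((T y κ : (Matrix n n ℂ)ˣ) : (Matrix n n ℂ)) - 1)‖ := by
          congr 1; noncomm_ring
      _ ≤ ‖(exp (X y κ) - 1) * ((T y κ : (Matrix n n ℂ)ˣ) : (Matrix n n ℂ))‖ + ‖((T y κ : (Matrix n n ℂ)ˣ) : (Matrix n n ℂ)) - 1‖ := norm_add_le _ _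
      _ ≤ 2 * s + ℓ := add_le_add (by rw [CStarRing.norm_mul_mem_unitary _ (mem_unitaryUnits.mp (hTU y κ))]; exact hE) (hT1 y κ)
  have hgU : ∀ y κ, gaugeAct (fun y => (w y)⁻¹) W y κ ∈ unitaryUnits (Matrix n n ℂ) := by
    intro y κ
    simp only [gaugeAct]
    exact (unitaryUnits (Matrix n n ℂ)).mul_mem ((unitaryUnits (Matrix n n ℂ)).mul_mem ((unitaryUnits (Matrix n n ℂ)).inv_mem (hwU _)) (hWu _ _))
      ((unitaryUnits (Matrix n n ℂ)).inv_mem ((unitaryUnits (Matrix n n ℂ)).inv_mem (hwU _)))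
  have h21 : 2 * s + ℓ < 1 := by linarith
  have hexp : ∀ (y : Site d) (κ : Fin d), ((gaugeAct (fun y => (w y)⁻¹) W y κ : (Matrix n n ℂ)ˣ) : (Matrix n n ℂ))
      = exp (mlog ((gaugeAct (fun y => (w y)⁻¹) W y κ : (Matrix n n ℂ)ˣ) : (Matrix n n ℂ))) := fun y κ => (exp_mlog ((hlink1 y κ).trans_lt h21)).symm
  have hlog : ∀ (y : Site d) (κ : Fin d), ‖mlog ((gaugeAct (fun y => (w y)⁻¹) W y κ : (Matrix n n ℂ)ˣ) : (Matrix n n ℂ))‖ ≤ 2 * (2 * s + ℓ) := by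
    intro y κ
    have h1 : ‖((gaugeAct (fun y => (w y)⁻¹) W y κ : (Matrix n n ℂ)ˣ) : (Matrix n n ℂ)) - 1‖ ≤ 1 / 2 := (hlink1 y κ).trans (by linarith)
    exact (norm_mlog_le_two_mul h1).trans (by linarith [hlink1 y κ])
  refine ⟨hexp, hlink1, hlog, fun x => ?_⟩
  -- the divergence
  have hsplit : covDiv (flatCfg (d := d) (n := n)) A' x
      = covDiv (flatCfg (d := d) (n := n)) X x + covDiv (flatCfg (d := d) (n := n)) D x + covDiv (flatCfg (d := d) (n := n)) R x := by
    have h1 : A' = fun y κ => (X y κ + D y κ) + R y κ := by funext y κ; exact hA'eq y κ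
    rw [h1, covDiv_flatCfg_add, covDiv_flatCfg_add]
  -- (a) conjugation by a slowly varying unitary
  have hXdiv : ‖covDiv (flatCfg (d := d) (n := n)) X x‖ ≤ ‖covDiv (flatCfg (d := d) (n := n)) A x‖ + 2 * d * ℓ * s := by
    have hid : covDiv (flatCfg (d := d) (n := n)) X x
        = Ad ((w x)⁻¹) (covDiv (flatCfg (d := d) (n := n)) A x) + ∑ μ : Fin d, (Ad ((w x)⁻¹) (A (x - e μ) μ) - Ad ((w (x - e μ))⁻¹) (A (x - e μ) μ)) := by
      rw [covDiv_flatCfg, covDiv_flatCfg]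
      simp only [hXdef, Ad, Finset.mul_sum, Finset.sum_mul, mul_sub, sub_mul, ← Finset.sum_add_distrib]
      exact Finset.sum_congr rfl fun μ _ => by abel
    rw [hid]
    refine (norm_add_le _ _).trans (add_le_add ?_ ?_)
    · simp only [Ad]
      rw [CStarRing.norm_mul_mem_unitary _ (mem_unitaryUnits.mp ((unitaryUnits (Matrix n n ℂ)).inv_mem ((unitaryUnits (Matrix n n ℂ)).inv_mem (hwU x)))),
        CStarRing.norm_mem_unitary_mul _ (mem_unitaryUnits.mp ((unitaryUnits (Matrix n n ℂ)).inv_mem (hwU x)))]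
    · calc ‖∑ μ : Fin d, (Ad ((w x)⁻¹) (A (x - e μ) μ) - Ad ((w (x - e μ))⁻¹) (A (x - e μ) μ))‖
          ≤ ∑ μ : Fin d, ‖Ad ((w x)⁻¹) (A (x - e μ) μ) - Ad ((w (x - e μ))⁻¹) (A (x - e μ) μ)‖ := norm_sum_le _ _
        _ ≤ ∑ _μ : Fin d, 2 * ℓ * s := sum_le_sum fun μ _ => by
            refine (norm_Ad_sub_Ad_le ((unitaryUnits (Matrix n n ℂ)).inv_mem (hwU x)) ((unitaryUnits (Matrix n n ℂ)).inv_mem (hwU (x - e μ))) _).trans ?_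
            rw [norm_inv_sub_inv (hwU x) (hwU (x - e μ))]
            have hwd : ‖(w x : (Matrix n n ℂ)) - w (x - e μ)‖ ≤ ℓ := by
              have := hℓ (x - e μ) μ; rwa [sub_add_cancel] at this
            exact mul_le_mul (mul_le_mul_of_nonneg_left hwd (by norm_num)) (hA _ _) (norm_nonneg _) (by positivity)
        _ = 2 * d * ℓ * s := by rw [sum_const, card_univ, Fintype.card_fin, nsmul_eq_mul]; ring
  -- (b) the pure gauge: a second difference of `w`
  have hDdiv : ‖covDiv (flatCfg (d := d) (n := n)) D x‖ ≤ 4 / 3 * d * (σ₂ + ℓ ^ 2) := by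
    rw [covDiv_flatCfg]
    calc ‖∑ μ : Fin d, (D x μ - D (x - e μ) μ)‖ ≤ ∑ μ : Fin d, ‖D x μ - D (x - e μ) μ‖ := norm_sum_le _ _
      _ ≤ ∑ _μ : Fin d, 4 / 3 * (σ₂ + ℓ ^ 2) := sum_le_sum fun μ _ => by
          simp only [hDdef]
          refine (norm_mlog_sub_mlog_le_four_thirds (ρ := ℓ) (by linarith) (hT1 x μ) (hT1 (x - e μ) μ)).trans ?_
          refine mul_le_mul_of_nonneg_left ?_ (by norm_num)
          simp only [hTdef]
          have h1 := hℓ x μ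
          have h2 : ‖(w x : (Matrix n n ℂ)) - w (x - e μ)‖ ≤ ℓ := by have := hℓ (x - e μ) μ; rwa [sub_add_cancel] at this
          have h := norm_transporter_second_diff_le (hwU (x - e μ)) (hwU x) (c := w (x + e μ)) h1 h2 (hσ₂ x μ)
          rw [sub_add_cancel]
          exact h
      _ = 4 / 3 * d * (σ₂ + ℓ ^ 2) := by rw [sum_const, card_univ, Fintype.card_fin, nsmul_eq_mul]; ring
  -- (c) the BCH junk
  have hRdiv : ‖covDiv (flatCfg (d := d) (n := n)) R x‖ ≤ 16384 * d * s * ℓ := by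
    refine (norm_covDiv_flatCfg_le R hR x).trans (le_of_eq ?_); ring
  rw [hsplit]
  calc _ ≤ ‖covDiv (flatCfg (d := d) (n := n)) X x‖ + ‖covDiv (flatCfg (d := d) (n := n)) D x‖ + ‖covDiv (flatCfg (d := d) (n := n)) R x‖ :=
        norm_add₃_le
    _ ≤ _ := by linarith [hXdiv, hDdiv, hRdiv]

end

end Summit.QuantumFields.BalabanUV.T4Continuum.NE7PinningDivergence
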